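import Literature.NumberTheory.Sieve.SmoothMinorArcsScaled
import Literature.NumberTheory.Sieve.SmoothMinorArcsSup
import Literature.NumberTheory.Sieve.SmoothLargeValuesPairs
import Literature.NumberTheory.Sieve.PsiPolylogLowerBound
import Mathlib.NumberTheory.DiophantineApproximation.Basic
import Mathlib.Analysis.Complex.ExponentialBounds
import HarnessLib

/-!
# Large values of exponential sums over smooth numbers, IIIa: the dilated sums (Harper's Prop. 3, tools)

Topic `Literature/NumberTheory/Sieve`; a PROVED file toward
`Literature.NumberTheory.DiophantineGeometry.XYZUpperHalf` ([Harper2016, Cor. 1]). Tools for the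
last part of the proof of Proposition 3 of op. cit. (§4, pp. 16–17): after
`sum_geomBound_prefix_le`, each exponential sum `∑_{m ∈ s_j} e(dmt)` is a difference of two sums
`∑_{n ≤ X'} e(n·dt)` with `√x ≤ X' ≤ x`; writing `t = a/q + η₀` with `q ≤ x^{3/5}`,
`|η₀| q x^{3/5} ≤ 1` and `dt = a_d/q_d + dη₀`, Theorem 1 at the scale `X'`
(`norm_smoothExpSum_le_scaled`) applies when `q_d ≤ x^{9/20}` and the crude bound
(`norm_smoothExpSum_le_crude`) otherwise:

* `norm_smoothExpSum_dilate_le` — for `0 < |d| ≤ 16K`, `x/(yK) − 1 ≤ X' ≤ 4x/K`: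
  `|∑_{n ≤ X', n∈S(y)} e(n·d(a/q+η₀))| ≤ C (log x)³ y^{(5/2)(1−α)} |d|^{1/2} (q(1+|η₀|x/(yK)))^e X'^α ζ̃ + 100(1+log x)² y² x^{4/5}`,
  `e = −1/2 + (3/2)(1−α)`, `α = α(x, y)`;
* `sum_Icc_erase_rpow_neg_half_le` (`∑_{0<|d|≤H} |d|^{−1/2} ≤ 4√H`), `crude_bound_aux2`,
  `nonmajor_leftover_aux` (numerics).

## References

* A. J. Harper, Compositio Math. 152 (2016) 1121–1158, §4, proof of Proposition 3 [Harper2016].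
-/

noncomputable section

open Finset Real
open scoped FourierTransform
open Literature.NumberTheory.Sieve.Vinogradov

namespace Literature.NumberTheory.Sieve

/-! ### Small tools -/

/-- `d^{-1/2} ≤ 2(√d − √(d−1))` for `d ≥ 1`. [folklore] -/
theorem rpow_neg_half_le_two_mul_sqrt_sub {d : ℝ} (hd : 1 ≤ d) :
    d ^ (-(1 / 2 : ℝ)) ≤ 2 * (Real.sqrt d - Real.sqrt (d - 1)) := by
  have hd0 : 0 < d := by linarith
  have hd1 : 0 ≤ d - 1 := by linarith
  have hs0 : 0 < Real.sqrt d := Real.sqrt_pos.mpr hd0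
  have hs1 : 0 ≤ Real.sqrt (d - 1) := Real.sqrt_nonneg _
  have hprod : (Real.sqrt d - Real.sqrt (d - 1)) * (Real.sqrt d + Real.sqrt (d - 1)) = 1 := by
    have h1 := Real.sq_sqrt hd0.le
    have h2 := Real.sq_sqrt hd1
    nlinarith
  have hle : Real.sqrt (d - 1) ≤ Real.sqrt d := Real.sqrt_le_sqrt (by linarith)
  rw [Real.rpow_neg hd0.le, ← Real.sqrt_eq_rpow]
  -- `1/√d ≤ 2 (√d - √(d-1))` iff `1 ≤ 2 √d (√d - √(d-1))`
  rw [inv_eq_one_div, div_le_iff₀ hs0]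
  nlinarith

/-- `∑_{0 < |d| ≤ H} |d|^{-1/2} ≤ 4 √H`. [folklore] -/
theorem sum_Icc_erase_rpow_neg_half_le (H : ℕ) :
    ∑ d ∈ (Finset.Icc (-(H : ℤ)) H).erase 0, |(d : ℝ)| ^ (-(1 / 2 : ℝ)) ≤ 4 * Real.sqrt H := by
  classical
  induction H with
  | zero => simp
  | succ n ih =>
    have hset : (Finset.Icc (-((n + 1 : ℕ) : ℤ)) ((n + 1 : ℕ) : ℤ)).erase 0 =
        insert ((n : ℤ) + 1) (insert (-((n : ℤ) + 1)) ((Finset.Icc (-(n : ℤ)) n).erase 0)) := by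
      ext d
      simp only [Finset.mem_erase, Finset.mem_Icc, Finset.mem_insert]
      push_cast
      omega
    have hnot1 : ((n : ℤ) + 1) ∉ insert (-((n : ℤ) + 1)) ((Finset.Icc (-(n : ℤ)) n).erase 0) := by
      simp only [Finset.mem_insert, Finset.mem_erase, Finset.mem_Icc]; omega
    have hnot2 : (-((n : ℤ) + 1)) ∉ (Finset.Icc (-(n : ℤ)) n).erase 0 := by
      simp only [Finset.mem_erase, Finset.mem_Icc]; omega
    rw [hset, Finset.sum_insert hnot1, Finset.sum_insert hnot2]
    have hkey := rpow_neg_half_le_two_mul_sqrt_sub (d := (n : ℝ) + 1) (by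
      have : (0 : ℝ) ≤ n := Nat.cast_nonneg n; linarith)
    have h1 : |(((n : ℤ) + 1 : ℤ) : ℝ)| = (n : ℝ) + 1 := by
      push_cast; exact abs_of_nonneg (by positivity)
    have h2 : |((-((n : ℤ) + 1) : ℤ) : ℝ)| = (n : ℝ) + 1 := by
      push_cast; rw [abs_neg]; exact abs_of_nonneg (by positivity)
    rw [h1, h2, show ((n : ℝ) + 1 - 1) = n by ring] at *
    push_cast
    linarith

/-! ### The crude range: numerics -/

/-- Numerical bookkeeping for the crude bound in the restriction argument: with `W₀ = √x`,
`K₀ = 16Ky`, `X' ≤ 4x/K`, `x^{9/20} < q' ≤ x^{3/5}`, the bound of `norm_smoothExpSum_le_crude`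
is at most `100 (1 + log x)² y² x^{4/5}`. [folklore] -/
theorem crude_bound_aux2 {x X' X2 : ℝ} {y q' K : ℕ} (hx1 : 1 < x) (hy1 : 1 ≤ (y : ℝ))
    (hK16 : 16 ≤ (K : ℝ)) (hX2 : X2 = x ^ (1 / 2 : ℝ)) (hX'0 : 0 < X') (hX'le : X' ≤ 4 * x / K)
    (hq'lo : x ^ (9 / 20 : ℝ) < q') (hq'hi : (q' : ℝ) ≤ x ^ (3 / 5 : ℝ))
    (hlogy : Real.log y ≤ Real.log x) :
    X2 + 2 * (1 + Real.log y) * Real.sqrt (2 * X') *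
        Real.sqrt (10 * X2 * y * (1 + Real.log y) + 32 * (16 * K * y) * X' * y / q' +
          16 * (16 * K * y) * X' * (y : ℝ) ^ 2 * (1 + Real.log q') / X2 + 4 * y * q' * (1 + Real.log q')) ≤
      100 * (1 + Real.log x) ^ 2 * (y : ℝ) ^ 2 * x ^ (4 / 5 : ℝ) := by
  have hx0 : 0 < x := by linarith
  set Lx := Real.log x with hLx
  have hLx0 : 0 ≤ Lx := Real.log_nonneg hx1.le
  have hy0 : (0 : ℝ) < y := by linarith
  have hK0 : (0 : ℝ) < K := by linarith
  have hq'0 : (0 : ℝ) < q' := lt_trans (by positivity) hq'lo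
  have hq'1 : (1 : ℝ) ≤ q' := by
    have : (1 : ℝ) ≤ x ^ (9 / 20 : ℝ) := Real.one_le_rpow hx1.le (by norm_num)
    linarith
  have hlogq : Real.log q' ≤ Lx := by
    rw [hLx]
    calc Real.log q' ≤ Real.log (x ^ (3 / 5 : ℝ)) := Real.log_le_log hq'0 hq'hi
      _ = 3 / 5 * Real.log x := Real.log_rpow hx0 _
      _ ≤ Real.log x := by have := Real.log_nonneg hx1.le; linarith
  have hlogq0 : 0 ≤ Real.log q' := Real.log_nonneg hq'1
  have hlogy0 : 0 ≤ Real.log y := Real.log_nonneg hy1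
  -- powers of `x`
  set A := x ^ (3 / 5 : ℝ) with hA
  set B := x ^ (1 / 5 : ℝ) with hB
  have hA0 : 0 < A := by positivity
  have hB1 : 1 ≤ B := Real.one_le_rpow hx1.le (by norm_num)
  have hX2B : X2 = B ^ (5 : ℕ) / B ^ (5 : ℕ) * X2 := by field_simp
  have hX2eq : X2 = x ^ (1 / 2 : ℝ) := hX2
  have hX2_0 : 0 < X2 := by rw [hX2]; positivity
  have hxAB : x = A * B * B := by rw [hA, hB, ← Real.rpow_add hx0, ← Real.rpow_add hx0]; norm_num
  have hX2leA : X2 ≤ A := by rw [hX2, hA]; exact Real.rpow_le_rpow_of_exponent_le hx1.le (by norm_num)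
  have hx920 : x ^ (9 / 20 : ℝ) * x ^ (11 / 20 : ℝ) = x := by rw [← Real.rpow_add hx0]; norm_num
  have h1120 : x ^ (11 / 20 : ℝ) ≤ A := by rw [hA]; exact Real.rpow_le_rpow_of_exponent_le hx1.le (by norm_num)
  have hX2sq : X2 * X2 = x := by rw [hX2, ← Real.rpow_add hx0]; norm_num
  -- the four terms are `≤ 1024 y³ A (1 + Lx)` each (crudely)
  set T : ℝ := (y : ℝ) ^ 3 * A * (1 + Lx) with hT
  have hT0 : 0 ≤ T := by positivity
  have hy3 : (y : ℝ) ≤ (y : ℝ) ^ 3 := by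
    calc (y : ℝ) = (y : ℝ) ^ 1 := (pow_one _).symm
      _ ≤ (y : ℝ) ^ 3 := pow_le_pow_right₀ hy1 (by norm_num)
  have hy23 : (y : ℝ) ^ 2 ≤ (y : ℝ) ^ 3 := pow_le_pow_right₀ hy1 (by norm_num)
  have ht1 : 10 * X2 * y * (1 + Real.log y) ≤ 10 * T := by
    rw [hT]
    calc 10 * X2 * y * (1 + Real.log y) = 10 * (y * X2 * (1 + Real.log y)) := by ring
      _ ≤ 10 * ((y : ℝ) ^ 3 * A * (1 + Lx)) := by gcongr
  have hKX' : (K : ℝ) * X' ≤ 4 * x := by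
    have := mul_le_mul_of_nonneg_left hX'le hK0.le
    calc (K : ℝ) * X' ≤ K * (4 * x / K) := this
      _ = 4 * x := by field_simp
  have ht2 : 32 * (16 * K * y) * X' * y / q' ≤ 2048 * T := by
    rw [hT, div_le_iff₀ hq'0]
    have h2 : x ≤ q' * A := by
      calc x = x ^ (9 / 20 : ℝ) * x ^ (11 / 20 : ℝ) := hx920.symm
        _ ≤ q' * A := mul_le_mul hq'lo.le h1120 (by positivity) hq'0.le
    calc 32 * (16 * K * y) * X' * y = 512 * (y : ℝ) ^ 2 * (K * X') := by ring
      _ ≤ 512 * (y : ℝ) ^ 2 * (4 * x) := by gcongr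
      _ ≤ 512 * (y : ℝ) ^ 3 * (4 * (q' * A)) := by gcongr
      _ = 2048 * ((y : ℝ) ^ 3 * A * 1) * q' := by ring
      _ ≤ 2048 * ((y : ℝ) ^ 3 * A * (1 + Lx)) * q' := by gcongr; linarith
  have ht3 : 16 * (16 * K * y) * X' * (y : ℝ) ^ 2 * (1 + Real.log q') / X2 ≤ 1024 * T := by
    rw [hT, div_le_iff₀ hX2_0]
    calc 16 * (16 * K * y) * X' * (y : ℝ) ^ 2 * (1 + Real.log q')
        = 256 * (y : ℝ) ^ 3 * (K * X') * (1 + Real.log q') := by ring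
      _ ≤ 256 * (y : ℝ) ^ 3 * (4 * x) * (1 + Lx) := by gcongr
      _ = 1024 * ((y : ℝ) ^ 3 * X2 * (1 + Lx)) * X2 := by rw [← hX2sq]; ring
      _ ≤ 1024 * ((y : ℝ) ^ 3 * A * (1 + Lx)) * X2 := by gcongr
  have ht4 : 4 * (y : ℝ) * q' * (1 + Real.log q') ≤ 4 * T := by
    rw [hT]
    calc 4 * (y : ℝ) * q' * (1 + Real.log q') = 4 * (y * q' * (1 + Real.log q')) := by ring
      _ ≤ 4 * ((y : ℝ) ^ 3 * A * (1 + Lx)) := by gcongr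
  have hroot : 10 * X2 * y * (1 + Real.log y) + 32 * (16 * K * y) * X' * y / q' +
      16 * (16 * K * y) * X' * (y : ℝ) ^ 2 * (1 + Real.log q') / X2 + 4 * y * q' * (1 + Real.log q') ≤ 4096 * T := by
    linarith only [ht1, ht2, ht3, ht4, hT0]
  -- `√(2X') √(2048 T) ≤ √(2 (2x/K) 2048 T) ≤ √(256 x T)` (K ≥ 16) and `x A = (x^{4/5})²`
  have hxA : x * A = (x ^ (4 / 5 : ℝ)) ^ 2 := by
    rw [hA, ← Real.rpow_natCast, ← Real.rpow_mul hx0.le,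
      show x * x ^ (3 / 5 : ℝ) = x ^ (1 : ℝ) * x ^ (3 / 5 : ℝ) by rw [Real.rpow_one], ← Real.rpow_add hx0]
    norm_num
  have hprod : 2 * X' * (4096 * T) ≤ (46 * (y : ℝ) ^ 2 * x ^ (4 / 5 : ℝ)) ^ 2 * (1 + Lx) := by
    have h1 : 2 * X' * 4096 ≤ 2048 * x := by
      have h2 : X' * K ≤ 4 * x := by rw [← le_div_iff₀ hK0]; exact hX'le
      have h3 : X' * 16 ≤ X' * K := mul_le_mul_of_nonneg_left hK16 hX'0.le
      linarith
    have hy34 : (y : ℝ) ^ 3 ≤ (y : ℝ) ^ 4 := pow_le_pow_right₀ hy1 (by norm_num)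
    have hxA0 : 0 ≤ x * A := by positivity
    calc 2 * X' * (4096 * T) = (2 * X' * 4096) * ((y : ℝ) ^ 3 * A * (1 + Lx)) := by rw [hT]; ring
      _ ≤ (2048 * x) * ((y : ℝ) ^ 4 * A * (1 + Lx)) := by gcongr
      _ = 2048 * ((y : ℝ) ^ 4 * (x * A) * (1 + Lx)) := by ring
      _ ≤ 2116 * ((y : ℝ) ^ 4 * (x * A) * (1 + Lx)) := by
          apply mul_le_mul_of_nonneg_right (by norm_num); positivity
      _ = (46 * (y : ℝ) ^ 2 * x ^ (4 / 5 : ℝ)) ^ 2 * (1 + Lx) := by rw [hxA]; ring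
  have hsq : Real.sqrt (2 * X') * Real.sqrt (4096 * T) ≤ 46 * (y : ℝ) ^ 2 * x ^ (4 / 5 : ℝ) * Real.sqrt (1 + Lx) := by
    rw [← Real.sqrt_mul (by positivity)]
    calc Real.sqrt (2 * X' * (4096 * T)) ≤ Real.sqrt ((46 * (y : ℝ) ^ 2 * x ^ (4 / 5 : ℝ)) ^ 2 * (1 + Lx)) :=
          Real.sqrt_le_sqrt hprod
      _ = 46 * (y : ℝ) ^ 2 * x ^ (4 / 5 : ℝ) * Real.sqrt (1 + Lx) := by
          rw [Real.sqrt_mul (by positivity), Real.sqrt_sq (by positivity)]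
  have hsqrtL : Real.sqrt (1 + Lx) ≤ 1 + Lx :=
    Real.sqrt_le_iff.mpr ⟨by linarith only [hLx0], by nlinarith only [hLx0]⟩
  have hX2le : X2 ≤ x ^ (4 / 5 : ℝ) := by rw [hX2]; exact Real.rpow_le_rpow_of_exponent_le hx1.le (by norm_num)
  have hone : (1 : ℝ) ≤ (1 + Lx) ^ 2 * (y : ℝ) ^ 2 :=
    one_le_mul_of_one_le_of_one_le (one_le_pow₀ (by linarith only [hLx0])) (one_le_pow₀ hy1)
  calc X2 + 2 * (1 + Real.log y) * Real.sqrt (2 * X') *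
        Real.sqrt (10 * X2 * y * (1 + Real.log y) + 32 * (16 * K * y) * X' * y / q' +
          16 * (16 * K * y) * X' * (y : ℝ) ^ 2 * (1 + Real.log q') / X2 + 4 * y * q' * (1 + Real.log q'))
      ≤ X2 + 2 * (1 + Lx) * Real.sqrt (2 * X') * Real.sqrt (4096 * T) := by gcongr
    _ ≤ x ^ (4 / 5 : ℝ) + 2 * (1 + Lx) * (46 * (y : ℝ) ^ 2 * x ^ (4 / 5 : ℝ) * (1 + Lx)) := by
        rw [mul_assoc (2 * (1 + Lx))]
        have hmid : Real.sqrt (2 * X') * Real.sqrt (4096 * T) ≤ 46 * (y : ℝ) ^ 2 * x ^ (4 / 5 : ℝ) * (1 + Lx) :=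
          hsq.trans (mul_le_mul_of_nonneg_left hsqrtL (by positivity))
        exact add_le_add hX2le (mul_le_mul_of_nonneg_left hmid (by positivity))
    _ = x ^ (4 / 5 : ℝ) * (1 + 92 * ((1 + Lx) ^ 2 * (y : ℝ) ^ 2)) := by ring
    _ ≤ x ^ (4 / 5 : ℝ) * (100 * ((1 + Lx) ^ 2 * (y : ℝ) ^ 2)) := by
        apply mul_le_mul_of_nonneg_left _ (by positivity); linarith only [hone]
    _ = 100 * (1 + Lx) ^ 2 * (y : ℝ) ^ 2 * x ^ (4 / 5 : ℝ) := by ring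

/-! ### One dilated sum `∑_{n ≤ X'} e(n · d t)` -/

set_option maxHeartbeats 12000000 in
-- a long assembly with a large context (the budget is cumulative over the declaration)
/-- **The dilated sums** `∑_{n ≤ X', n ∈ S(y)} e(n·d(a/q + η₀))` for `0 < |d| ≤ 16K`,
`x/(yK) − 1 ≤ X' ≤ 4x/K`, `q ≤ x^{3/5}`, `(a,q) = 1`, `|η₀| q x^{3/5} ≤ 1`: writing `d a/q = a_d/q_d`
in lowest terms, Theorem 1 at the scale `X'` applies when `q_d ≤ x^{9/20}` (and then
`(q_d L)^e ≤ |d|^{1/2} (q(1 + |η₀| x/(yK)))^e`), and the crude bound otherwise.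
[cite: Harper2016, §4, proof of Proposition 3 (pp. 16–17)] -/
theorem norm_smoothExpSum_dilate_le :
    ∃ C x₀ : ℝ, 0 < C ∧ ∀ (x : ℝ) (y : ℕ), x₀ ≤ x → Real.log x ^ 8 ≤ y →
      Real.log y ≤ 1 / 2 * Real.log x ^ (1 / 6 : ℝ) → (y : ℝ) ^ 200 ≤ x →
      ∀ (K : ℕ), 16 ≤ K → (K : ℝ) ^ 1000 ≤ x →
      ∀ (q : ℕ), 1 ≤ q → (q : ℝ) ≤ x ^ (3 / 5 : ℝ) → ∀ (a : ℤ), IsCoprime a (q : ℤ) →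
      ∀ (η₀ : ℝ), |η₀| * q * x ^ (3 / 5 : ℝ) ≤ 1 →
      ∀ (d : ℤ), d ≠ 0 → |(d : ℝ)| ≤ 16 * K → ∀ X' : ℝ, x / (y * K) - 1 ≤ X' → X' ≤ 4 * x / K →
        ‖∑ n ∈ Nat.smoothNumbersUpTo ⌊X'⌋₊ (y + 1), (𝐞 ((n : ℝ) * ((d : ℝ) * ((a : ℝ) / q + η₀))) : ℂ)‖ ≤
          C * Real.log x ^ 3 * (y : ℝ) ^ (5 / 2 * (1 - saddlePoint x y)) * |(d : ℝ)| ^ (1 / 2 : ℝ) *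
            ((q : ℝ) * (1 + |η₀| * (x / (y * K)))) ^ (-(1 / 2 : ℝ) + 3 / 2 * (1 - saddlePoint x y)) *
            (X' ^ saddlePoint x y *
              (smoothZeta (saddlePoint x y) y / Real.sqrt (saddlePhi₂ (saddlePoint x y) y))) +
          100 * (1 + Real.log x) ^ 2 * (y : ℝ) ^ 2 * x ^ (4 / 5 : ℝ) := by
  classical
  obtain ⟨C_s, x₀s, hC_s, hS⟩ := norm_smoothExpSum_le_scaled
  obtain ⟨x₀F, h1720⟩ := seventeen_twentieths_le_saddlePoint
  obtain ⟨x₀1, hlt1⟩ := saddlePoint_lt_one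
  refine ⟨C_s, max (max x₀s x₀F) (max x₀1 (Real.exp 400)), hC_s,
    fun x y hx hy8 hy6 hy200 K hK16 hK1000 q hq1 hqx a hcop η₀ hη₀ d hd0 hd16 X' hX'lo hX'hi => ?_⟩
  have hx₀s : x₀s ≤ x := le_trans ((le_max_left _ _).trans (le_max_left _ _)) hx
  have hx₀F : x₀F ≤ x := le_trans ((le_max_right _ _).trans (le_max_left _ _)) hx
  have hx₀1 : x₀1 ≤ x := le_trans ((le_max_left _ _).trans (le_max_right _ _)) hx
  have hxe : Real.exp 400 ≤ x := le_trans ((le_max_right _ _).trans (le_max_right _ _)) hx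
  have hK16r : (16 : ℝ) ≤ K := by exact_mod_cast hK16
  ------------------------------------------------------------------
  -- ### the range
  set Lx := Real.log x with hLx
  have hLx400 : 400 ≤ Lx := by
    have := Real.log_le_log (Real.exp_pos _) hxe; rwa [Real.log_exp] at this
  have hx1 : 1 < x := by
    have : (1 : ℝ) < Real.exp 400 := by have := Real.add_one_le_exp (400 : ℝ); linarith
    exact lt_of_lt_of_le this hxe
  have hx0 : 0 < x := by linarith
  have hLx1 : 1 ≤ Lx := by linarith
  have hLx0 : 0 ≤ Lx := by linarith
  have hy4 : Lx ^ 4 ≤ y := le_trans (pow_le_pow_right₀ hLx1 (by norm_num)) hy8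
  have hyL : Lx ≤ y := by
    calc Lx = Lx ^ 1 := (pow_one _).symm
      _ ≤ Lx ^ 8 := pow_le_pow_right₀ hLx1 (by norm_num)
      _ = _ := rfl
      _ ≤ y := hy8
  have hy1 : (1 : ℝ) ≤ y := by linarith
  have hy0 : (0 : ℝ) < y := by linarith
  have hy2 : 2 ≤ y := by exact_mod_cast (show (2 : ℝ) ≤ y by linarith)
  have hlogy : Real.log y ≤ Lx := by
    refine hy6.trans ?_
    have h1 : Lx ^ (1 / 6 : ℝ) ≤ Lx := by
      calc Lx ^ (1 / 6 : ℝ) ≤ Lx ^ (1 : ℝ) := Real.rpow_le_rpow_of_exponent_le hLx1 (by norm_num)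
        _ = Lx := Real.rpow_one _
    have : 0 ≤ Lx ^ (1 / 6 : ℝ) := by positivity
    linarith
  have hyx : (y : ℝ) ≤ x := by
    rw [← Real.exp_log hy0, ← Real.exp_log hx0]; exact Real.exp_le_exp.mpr hlogy
  have hK0 : (0 : ℝ) < K := by linarith
  have hq0 : (0 : ℝ) < q := by exact_mod_cast hq1
  have hq1r : (1 : ℝ) ≤ q := by exact_mod_cast hq1
  set α := saddlePoint x y with hαdef
  have hα : 17 / 20 ≤ α := h1720 x y hx₀F hy8 hyx
  have hα1 : α ≤ 1 := by
    have hy3 : Real.log x ^ 3 ≤ y := le_trans (pow_le_pow_right₀ hLx1 (by norm_num)) hy8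
    have hy6' : Real.log y ≤ Real.log x ^ (1 / 6 : ℝ) := by
      refine hy6.trans ?_
      have : 0 ≤ Lx ^ (1 / 6 : ℝ) := by positivity
      rw [hLx] at this ⊢; linarith
    exact (hlt1 x y hx₀1 hy3 hyx hy6').le
  set e : ℝ := -(1 / 2 : ℝ) + 3 / 2 * (1 - α) with he
  have he0 : e ≤ 0 := by rw [he]; linarith
  have hehalf : -e ≤ 1 / 2 := by rw [he]; linarith
  set ζt := smoothZeta α y / Real.sqrt (saddlePhi₂ α y) with hζt
  have hζt0 : 0 ≤ ζt := div_nonneg (smoothZeta_pos (by linarith)).le (Real.sqrt_nonneg _)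
  -- powers of `x`
  set X5 := x ^ (3 / 5 : ℝ) with hX5  -- `x^{3/5}`
  set X9 := x ^ (9 / 20 : ℝ) with hX9
  set X2 := x ^ (1 / 2 : ℝ) with hX2
  have hX5_1 : 1 ≤ X5 := Real.one_le_rpow hx1.le (by norm_num)
  have hX9_1 : 1 ≤ X9 := Real.one_le_rpow hx1.le (by norm_num)
  have hX2_1 : 1 ≤ X2 := Real.one_le_rpow hx1.le (by norm_num)
  -- smallness of `y`, `K` as powers of `x`: `y ≤ x^{1/200}`, `K ≤ x^{1/1000}`
  set x200 := x ^ (1 / 200 : ℝ) with hx200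
  set x1000 := x ^ (1 / 1000 : ℝ) with hx1000
  have hx200pow : x200 ^ (200 : ℕ) = x := by
    rw [hx200, ← Real.rpow_natCast, ← Real.rpow_mul hx0.le]; norm_num
  have hx1000pow : x1000 ^ (1000 : ℕ) = x := by
    rw [hx1000, ← Real.rpow_natCast, ← Real.rpow_mul hx0.le]; norm_num
  have hyx200 : (y : ℝ) ≤ x200 :=
    le_of_pow_le_pow_left₀ (by norm_num) (by positivity) (hy200.trans_eq hx200pow.symm)
  have hKx1000 : (K : ℝ) ≤ x1000 :=
    le_of_pow_le_pow_left₀ (by norm_num) (by positivity) (hK1000.trans_eq hx1000pow.symm)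
  -- `W = x/(yK)`
  set W := x / (y * K) with hW
  have hyK0 : (0 : ℝ) < y * K := by positivity
  have hW0 : 0 < W := by positivity
  -- `W ≥ x^{0.99}`-type: `W ≥ x / (x200 * x1000) = x^{1 - 1/200 - 1/1000}`; we use `W ≥ 4 X2` and `W ≥ 40 X9² y³ …`
  have hWge : x / (x200 * x1000) ≤ W := by
    rw [hW]; exact div_le_div_of_nonneg_left hx0.le hyK0 (by gcongr)
  have hxfrac : x / (x200 * x1000) = x ^ (994 / 1000 : ℝ) := by
    rw [hx200, hx1000, ← Real.rpow_add hx0, div_eq_iff (by positivity), ← Real.rpow_add hx0]; norm_num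
  rw [hxfrac] at hWge
  -- numeric consequences (all via `x ≥ e^{400}`): `X2 ≤ W/4`, `18 X9² y³ ≤ W/2 - …`
  have hx994 : (4 : ℝ) * X2 ≤ x ^ (994 / 1000 : ℝ) := by
    -- `x^{994/1000 - 1/2} ≥ x^{0.49} ≥ 4`
    have h1 : x ^ (994 / 1000 : ℝ) = X2 * x ^ (494 / 1000 : ℝ) := by rw [hX2, ← Real.rpow_add hx0]; norm_num
    have h2 : (4 : ℝ) ≤ x ^ (494 / 1000 : ℝ) := by
      have : Real.exp (400 * (494 / 1000)) ≤ x ^ (494 / 1000 : ℝ) := by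
        rw [← Real.exp_log hx0, ← Real.exp_mul, hLx.symm] at *
        exact Real.exp_le_exp.mpr (by nlinarith)
      have h4 : (4 : ℝ) ≤ Real.exp (400 * (494 / 1000)) := by
        have := Real.add_one_le_exp (400 * (494 / 1000) : ℝ); linarith
      linarith
    rw [h1]; nlinarith [hX2_1]
  have hWX2 : 4 * X2 ≤ W := hx994.trans hWge
  have hW2 : 2 ≤ W := by linarith
  have hX'sqrt : X2 ≤ X' := by linarith
  have hX'0 : 0 < X' := by linarith
  have hX'x : X' ≤ x := by
    calc X' ≤ 4 * x / K := hX'hi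
      _ ≤ 4 * x / 16 := by gcongr
      _ ≤ x := by linarith
  have hX'W : W / 2 ≤ X' := by linarith
  ------------------------------------------------------------------
  -- ### `d a / q = a_d / q_d`
  have hgpos : 0 < Int.gcd d (q : ℤ) := Int.gcd_pos_of_ne_zero_left _ hd0
  obtain ⟨g, d', q', hg0, hcop', hdg, hqg⟩ := Int.exists_gcd_one' hgpos
  have hq'pos : 0 < q' := by
    have : (0 : ℤ) < q' * g := by rw [← hqg]; exact_mod_cast hq1
    exact pos_of_mul_pos_left this (by exact_mod_cast hg0.le)
  set qd : ℕ := q'.toNat with hqd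
  have hqdq' : (qd : ℤ) = q' := Int.toNat_of_nonneg hq'pos.le
  have hqd1 : 1 ≤ qd := by
    have : (1 : ℤ) ≤ qd := by rw [hqdq']; exact hq'pos
    exact_mod_cast this
  have hqd0 : (0 : ℝ) < qd := by exact_mod_cast hqd1
  have hg0r : (0 : ℝ) < g := by exact_mod_cast hg0
  have hqeq : (q : ℝ) = qd * g := by
    have : ((q : ℤ) : ℝ) = ((q' * g : ℤ) : ℝ) := by rw [hqg]
    push_cast at this
    rw [← hqdq'] at this; exact_mod_cast this
  have hdeq : (d : ℝ) = d' * g := by exact_mod_cast hdg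
  have hcopd : IsCoprime (d' * a) (qd : ℤ) := by
    rw [hqdq']
    apply IsCoprime.mul_left (Int.isCoprime_iff_gcd_eq_one.mpr hcop')
    apply IsCoprime.of_isCoprime_of_dvd_right hcop
    exact ⟨g, hqg⟩
  have hphase : (d : ℝ) * ((a : ℝ) / q + η₀) = (((d' * a : ℤ)) : ℝ) / qd + d * η₀ := by
    rw [hqeq, hdeq]; push_cast; field_simp
  -- bounds on `qd`
  have hqdle : (qd : ℝ) ≤ q := by
    rw [hqeq]; have : (1 : ℝ) ≤ g := by exact_mod_cast hg0
    nlinarith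
  have hgle : (g : ℝ) ≤ |(d : ℝ)| := by
    have h1 : (g : ℤ) ∣ d := ⟨d', by rw [hdg]; ring⟩
    have h2 : ((g : ℤ) : ℝ) ≤ ((|d| : ℤ) : ℝ) := by
      exact_mod_cast Int.le_of_dvd (abs_pos.mpr hd0) ((dvd_abs _ _).mpr h1)
    push_cast at h2; exact h2
  have hd1 : (1 : ℝ) ≤ |(d : ℝ)| := by
    have : (1 : ℤ) ≤ |d| := Int.one_le_abs hd0
    have : ((1 : ℤ) : ℝ) ≤ ((|d| : ℤ) : ℝ) := by exact_mod_cast this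
    push_cast at this; exact this
  have hqqd : (q : ℝ) ≤ qd * |(d : ℝ)| := by rw [hqeq]; gcongr
  -- `|d η₀| ≤ 16 K / (q X5)`
  have hdη : |(d : ℝ) * η₀| * (q * X5) ≤ 16 * K := by
    rw [abs_mul]
    calc |(d : ℝ)| * |η₀| * (q * X5) = |(d : ℝ)| * (|η₀| * q * X5) := by ring
      _ ≤ 16 * K * 1 := mul_le_mul hd16 (by rw [hX5]; exact hη₀) (by positivity) (by positivity)
      _ = 16 * K := mul_one _
  rw [hphase]
  ------------------------------------------------------------------
  -- ### the two cases
  set MainT : ℝ := C_s * Real.log x ^ 3 * (y : ℝ) ^ (5 / 2 * (1 - α)) * |(d : ℝ)| ^ (1 / 2 : ℝ) *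
    ((q : ℝ) * (1 + |η₀| * W)) ^ e * (X' ^ α * ζt) with hMainT
  have hMainT0 : 0 ≤ MainT := by positivity
  set CrudeT : ℝ := 100 * (1 + Lx) ^ 2 * (y : ℝ) ^ 2 * x ^ (4 / 5 : ℝ) with hCrudeT
  have hCrudeT0 : 0 ≤ CrudeT := by positivity
  suffices hgoal : ‖∑ n ∈ Nat.smoothNumbersUpTo ⌊X'⌋₊ (y + 1),
      (𝐞 ((n : ℝ) * ((((d' * a : ℤ)) : ℝ) / qd + d * η₀)) : ℂ)‖ ≤ MainT + CrudeT by
    rw [hMainT, hCrudeT, he, hζt, hW, hLx] at hgoal; exact hgoal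
  rcases le_or_gt (qd : ℝ) X9 with hcaseA | hcaseB
  · ------------------------------------------------------------
    -- Case A: Theorem 1 at the scale `X'`
    set L := 2 * (1 + |(d : ℝ) * η₀| * X') with hL
    have hL2 : 2 ≤ L := by
      have h0 : 0 ≤ |(d : ℝ) * η₀| * X' := by positivity
      rw [hL]; linarith
    -- `qd L ≤ 3 X9`
    have hqdL : (qd : ℝ) * L ≤ 3 * X9 := by
      -- `qd |dη₀| X' ≤ q |dη₀| X' ≤ 16 K X'/X5 ≤ 64 x/X5 = 64 x^{2/5} ≤ X9/2`
      have h1 : (qd : ℝ) * (|(d : ℝ) * η₀| * X') ≤ 16 * K * X' / X5 := by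
        rw [le_div_iff₀ (by positivity)]
        calc (qd : ℝ) * (|(d : ℝ) * η₀| * X') * X5 = (|(d : ℝ) * η₀| * (qd * X5)) * X' := by ring
          _ ≤ (|(d : ℝ) * η₀| * (q * X5)) * X' := by gcongr
          _ ≤ 16 * K * X' := by gcongr
      have h2 : 16 * (K : ℝ) * X' / X5 ≤ X9 / 2 := by
        rw [div_le_iff₀ (by positivity)]
        have h3 : (K : ℝ) * X' ≤ 4 * x := by
          have := mul_le_mul_of_nonneg_left hX'hi hK0.le
          calc (K : ℝ) * X' ≤ K * (4 * x / K) := this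
            _ = 4 * x := by field_simp
        -- `128 x ≤ X9 X5 = x^{21/20}` i.e. `128 ≤ x^{1/20}`
        have h4 : X9 * X5 = x * x ^ (1 / 20 : ℝ) := by
          rw [hX9, hX5, ← Real.rpow_add hx0, show x * x ^ (1 / 20 : ℝ) = x ^ (1 : ℝ) * x ^ (1 / 20 : ℝ) by
            rw [Real.rpow_one], ← Real.rpow_add hx0]; norm_num
        have h5 : (128 : ℝ) ≤ x ^ (1 / 20 : ℝ) := by
          have : Real.exp (400 * (1 / 20)) ≤ x ^ (1 / 20 : ℝ) := by
            rw [← Real.exp_log hx0, ← Real.exp_mul]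
            exact Real.exp_le_exp.mpr (by rw [← hLx]; nlinarith)
          have h6 : (128 : ℝ) ≤ Real.exp (400 * (1 / 20)) := by
            have h7 : Real.exp (400 * (1 / 20)) = Real.exp 5 ^ 4 := by
              rw [← Real.exp_nat_mul]; norm_num
            have h8 : (6 : ℝ) ≤ Real.exp 5 := by have := Real.add_one_le_exp (5 : ℝ); linarith
            rw [h7]
            calc (128 : ℝ) ≤ 6 ^ 4 := by norm_num
              _ ≤ Real.exp 5 ^ 4 := pow_le_pow_left₀ (by norm_num) h8 4
          linarith
        nlinarith [h4, h5, hx0]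
      calc (qd : ℝ) * L = 2 * qd + 2 * (qd * (|(d : ℝ) * η₀| * X')) := by rw [hL]; ring
        _ ≤ 2 * X9 + 2 * (X9 / 2) := by gcongr; exact h1.trans h2
        _ = 3 * X9 := by ring
    -- hypothesis of Theorem 1: `qd² L² y³ ≤ X'`
    have hH : (qd : ℝ) ^ 2 * L ^ 2 * (y : ℝ) ^ 3 ≤ X' := by
      have h1 : (qd : ℝ) ^ 2 * L ^ 2 * (y : ℝ) ^ 3 = ((qd : ℝ) * L) ^ 2 * (y : ℝ) ^ 3 := by ring
      rw [h1]
      have h2 : ((qd : ℝ) * L) ^ (2 : ℕ) * (y : ℝ) ^ (3 : ℕ) ≤ (3 * X9) ^ (2 : ℕ) * x200 ^ (3 : ℕ) := by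
        have hqL0 : 0 ≤ (qd : ℝ) * L := mul_nonneg hqd0.le (by linarith)
        exact mul_le_mul (pow_le_pow_left₀ hqL0 hqdL 2) (pow_le_pow_left₀ hy0.le hyx200 3)
          (by positivity) (by positivity)
      refine h2.trans ?_
      -- `9 x^{9/10} x^{3/200} ≤ x^{994/1000}/2 ≤ W/2 ≤ X'`
      have hX9sq : X9 ^ (2 : ℕ) = x ^ (9 / 10 : ℝ) := by
        rw [hX9, ← Real.rpow_natCast, ← Real.rpow_mul hx0.le]; norm_num
      have hx200cube : x200 ^ (3 : ℕ) = x ^ (3 / 200 : ℝ) := by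
        rw [hx200, ← Real.rpow_natCast, ← Real.rpow_mul hx0.le]; norm_num
      have h3 : (3 * X9) ^ (2 : ℕ) * x200 ^ (3 : ℕ) = 9 * x ^ (183 / 200 : ℝ) := by
        rw [mul_pow, hX9sq, hx200cube, mul_assoc, ← Real.rpow_add hx0]; norm_num
      have h4 : 9 * x ^ (183 / 200 : ℝ) ≤ x ^ (994 / 1000 : ℝ) / 2 := by
        have h5 : x ^ (994 / 1000 : ℝ) = x ^ (183 / 200 : ℝ) * x ^ (79 / 1000 : ℝ) := by
          rw [← Real.rpow_add hx0]; norm_num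
        have h6 : (18 : ℝ) ≤ x ^ (79 / 1000 : ℝ) := by
          have : Real.exp (400 * (79 / 1000)) ≤ x ^ (79 / 1000 : ℝ) := by
            rw [← Real.exp_log hx0, ← Real.exp_mul]
            exact Real.exp_le_exp.mpr (by rw [← hLx]; nlinarith)
          have h7 : (18 : ℝ) ≤ Real.exp (400 * (79 / 1000)) := by
            have := Real.add_one_le_exp (400 * (79 / 1000) : ℝ); norm_num at this ⊢; linarith
          linarith
        rw [h5]
        have : 0 ≤ x ^ (183 / 200 : ℝ) := by positivity
        nlinarith
      rw [h3]; linarith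
    have key := hS x y hx₀s hy4 hy6 X' hX'sqrt hX'x qd (by omega) (d' * a) hcopd ((d : ℝ) * η₀) (by
      rw [← hL]; exact hH)
    rw [← hαdef, ← hL] at key
    -- `(qd L)^e ≤ |d|^{1/2} (q(1+|η₀|W))^e`
    have hqdLlo : (q : ℝ) * (1 + |η₀| * W) / |(d : ℝ)| ≤ qd * L := by
      rw [div_le_iff₀ (by linarith)]
      have h1 : 1 + |η₀| * W ≤ L := by
        -- `L = 2 + 2 |d| |η₀| X' ≥ 2 + 2 |η₀| (W/2) …` using `|d| ≥ 1`, `X' ≥ W/2`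
        rw [hL, abs_mul]
        have : |η₀| * W ≤ 2 * (|(d : ℝ)| * |η₀| * X') := by
          have h0 : 0 ≤ |η₀| := abs_nonneg _
          calc |η₀| * W = |η₀| * (2 * (W / 2)) := by ring
            _ ≤ |η₀| * (2 * X') := by gcongr
            _ = 2 * (1 * |η₀| * X') := by ring
            _ ≤ 2 * (|(d : ℝ)| * |η₀| * X') := by gcongr
        linarith
      calc (q : ℝ) * (1 + |η₀| * W) ≤ (qd * |(d : ℝ)|) * L :=
            mul_le_mul hqqd h1 (by positivity) (by positivity)
        _ = qd * L * |(d : ℝ)| := by ring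
    have hbase0 : 0 < (q : ℝ) * (1 + |η₀| * W) / |(d : ℝ)| := by positivity
    have hpow : ((qd : ℝ) * L) ^ e ≤ |(d : ℝ)| ^ (1 / 2 : ℝ) * ((q : ℝ) * (1 + |η₀| * W)) ^ e := by
      calc ((qd : ℝ) * L) ^ e ≤ ((q : ℝ) * (1 + |η₀| * W) / |(d : ℝ)|) ^ e :=
            Real.rpow_le_rpow_of_nonpos hbase0 hqdLlo he0
        _ = |(d : ℝ)| ^ (-e) * ((q : ℝ) * (1 + |η₀| * W)) ^ e := by
            rw [Real.div_rpow (by positivity) (by positivity), Real.rpow_neg (by positivity)]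
            field_simp
        _ ≤ |(d : ℝ)| ^ (1 / 2 : ℝ) * ((q : ℝ) * (1 + |η₀| * W)) ^ e := by
            apply mul_le_mul_of_nonneg_right _ (by positivity)
            exact Real.rpow_le_rpow_of_exponent_le hd1 hehalf
    calc ‖∑ n ∈ Nat.smoothNumbersUpTo ⌊X'⌋₊ (y + 1), (𝐞 ((n : ℝ) * ((((d' * a : ℤ)) : ℝ) / qd + d * η₀)) : ℂ)‖
        ≤ C_s * Real.log x ^ 3 * (y : ℝ) ^ (5 / 2 * (1 - α)) * ((qd : ℝ) * L) ^ (-(1 / 2 : ℝ) + 3 / 2 * (1 - α)) *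
            (X' ^ α * (smoothZeta α y / Real.sqrt (saddlePhi₂ α y))) := key
      _ = C_s * Real.log x ^ 3 * (y : ℝ) ^ (5 / 2 * (1 - α)) * ((qd : ℝ) * L) ^ e * (X' ^ α * ζt) := by rw [he, hζt]
      _ ≤ C_s * Real.log x ^ 3 * (y : ℝ) ^ (5 / 2 * (1 - α)) * (|(d : ℝ)| ^ (1 / 2 : ℝ) * ((q : ℝ) * (1 + |η₀| * W)) ^ e) *
            (X' ^ α * ζt) := by
          apply mul_le_mul_of_nonneg_right _ (by positivity)
          exact mul_le_mul_of_nonneg_left hpow (by positivity)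
      _ = MainT := by rw [hMainT]; ring
      _ ≤ MainT + CrudeT := le_add_of_nonneg_right hCrudeT0
  · ------------------------------------------------------------
    -- Case B: the crude bound with `W₀ = X2`, `K₀ = 16 K y`
    have hK₀ : (y : ℝ) * |(d : ℝ) * η₀| * (qd : ℝ) ^ 2 ≤ 16 * K * y := by
      -- `y |dη₀| qd² ≤ y · (16K/(q X5)) · qd · q ≤ …`, using `qd ≤ q ≤ X5`
      have h1 : |(d : ℝ) * η₀| * (qd : ℝ) ^ 2 ≤ 16 * K := by
        have h2 : (qd : ℝ) ^ 2 ≤ q * X5 := by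
          calc (qd : ℝ) ^ 2 = qd * qd := by ring
            _ ≤ q * X5 := mul_le_mul hqdle (hqdle.trans (by rw [hX5]; exact hqx)) hqd0.le hq0.le
        calc |(d : ℝ) * η₀| * (qd : ℝ) ^ 2 ≤ |(d : ℝ) * η₀| * (q * X5) := by gcongr
          _ ≤ 16 * K := hdη
      calc (y : ℝ) * |(d : ℝ) * η₀| * (qd : ℝ) ^ 2 = (y : ℝ) * (|(d : ℝ) * η₀| * (qd : ℝ) ^ 2) := by ring
        _ ≤ (y : ℝ) * (16 * K) := by gcongr
        _ = 16 * (K : ℝ) * y := by ring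
    have hX2_8 : (8 : ℝ) ≤ X2 := by
      have : Real.exp (400 * (1 / 2)) ≤ X2 := by
        rw [hX2, ← Real.exp_log hx0, ← Real.exp_mul]
        exact Real.exp_le_exp.mpr (by rw [← hLx]; nlinarith)
      have h8 : (8 : ℝ) ≤ Real.exp (400 * (1 / 2)) := by
        have := Real.add_one_le_exp (400 * (1 / 2) : ℝ); norm_num at this ⊢; linarith
      linarith
    have hX'16 : (16 : ℝ) ≤ X' := by linarith [hX2_8, hWX2, hX'W]
    have hK₀1 : (1 : ℝ) ≤ 16 * K * y := by nlinarith [hK16r, hy1]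
    have hyX2 : (y : ℝ) ≤ X2 := by
      -- `y ≤ x200 ≤ X2`
      refine hyx200.trans ?_
      rw [hx200, hX2]; exact Real.rpow_le_rpow_of_exponent_le hx1.le (by norm_num)
    have key := norm_smoothExpSum_le_crude (x := X') (W₀ := X2) (K₀ := 16 * K * y) (δ := (d : ℝ) * η₀) (y := y)
      (q := qd) (a := d' * a) hX'16 hy2 hqd1 hcopd hK₀1 hK₀ hyX2 hX'sqrt
    refine key.trans (le_add_of_nonneg_of_le hMainT0 ?_)
    rw [hCrudeT]
    have hqdhi : (qd : ℝ) ≤ x ^ (3 / 5 : ℝ) := hqdle.trans (by rw [hX5] at hqx; exact hqx)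
    exact crude_bound_aux2 (K := K) hx1 hy1 hK16r hX2 hX'0 hX'hi hcaseB hqdhi hlogy

/-! ### Differences off the fairly-major arcs -/

/-- Numerics for the leftover terms: for `log x ≥ 1000`, `y ≤ x^{1/200}`, `K ≤ x^{1/1000}`:
`19200 log x (1 + log x)² y³ K² x^{4/5} ≤ x^{19/20}`. [folklore] -/
theorem nonmajor_leftover_aux {x : ℝ} {y K : ℕ} (hx : Real.exp 1000 ≤ x) (hy1 : 1 ≤ (y : ℝ))
    (hK1 : 1 ≤ (K : ℝ)) (hy : (y : ℝ) ≤ x ^ (1 / 200 : ℝ)) (hK : (K : ℝ) ≤ x ^ (1 / 1000 : ℝ)) :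
    19200 * Real.log x * (1 + Real.log x) ^ 2 * (y : ℝ) ^ 3 * (K : ℝ) ^ 2 * x ^ (4 / 5 : ℝ) ≤
      x ^ (19 / 20 : ℝ) := by
  have hx0 : 0 < x := lt_of_lt_of_le (Real.exp_pos _) hx
  set L := Real.log x with hL
  have hL1000 : 1000 ≤ L := by
    have := Real.log_le_log (Real.exp_pos _) hx; rwa [Real.log_exp] at this
  have hL0 : 0 ≤ L := by linarith
  -- `(1+L) ≤ 40 e^{L/40}`
  have h1 : 1 + L ≤ 40 * Real.exp (L / 40) := by
    have := Real.add_one_le_exp (L / 40); linarith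
  have h2 : L * (1 + L) ^ 2 ≤ (1 + L) ^ 3 := by nlinarith
  have h3 : (1 + L) ^ 3 ≤ 64000 * Real.exp (3 * L / 40) := by
    have h0 : 0 ≤ 1 + L := by linarith
    calc (1 + L) ^ 3 ≤ (40 * Real.exp (L / 40)) ^ 3 := pow_le_pow_left₀ h0 h1 3
      _ = 64000 * Real.exp (L / 40) ^ 3 := by ring
      _ = 64000 * Real.exp (3 * L / 40) := by rw [← Real.exp_nat_mul]; ring_nf
  have h4 : (19200 : ℝ) * 64000 ≤ Real.exp (L / 40) := by
    have h5 : (25 : ℝ) ≤ L / 40 := by linarith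
    have h6 : Real.exp 25 ≤ Real.exp (L / 40) := Real.exp_le_exp.mpr h5
    have h7 : (19200 : ℝ) * 64000 ≤ Real.exp 25 := by
      have h8 : Real.exp 25 = Real.exp 1 ^ 25 := by rw [← Real.exp_nat_mul]; norm_num
      have h9 := Real.exp_one_gt_d9
      calc (19200 : ℝ) * 64000 ≤ (2.7182818283 : ℝ) ^ 25 := by norm_num
        _ ≤ Real.exp 1 ^ 25 := pow_le_pow_left₀ (by norm_num) h9.le 25
        _ = Real.exp 25 := h8.symm
    linarith
  have hlogs : 19200 * L * (1 + L) ^ 2 ≤ x ^ (1 / 10 : ℝ) := by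
    have hx10 : x ^ (1 / 10 : ℝ) = Real.exp (L / 40) * Real.exp (3 * L / 40) := by
      rw [← Real.exp_add, Real.rpow_def_of_pos hx0, hL]; congr 1; ring
    rw [hx10]
    calc 19200 * L * (1 + L) ^ 2 ≤ 19200 * (1 + L) ^ 3 := by nlinarith
      _ ≤ 19200 * (64000 * Real.exp (3 * L / 40)) := by gcongr
      _ = (19200 * 64000) * Real.exp (3 * L / 40) := by ring
      _ ≤ Real.exp (L / 40) * Real.exp (3 * L / 40) := by gcongr
  have hyK : (y : ℝ) ^ 3 * (K : ℝ) ^ 2 ≤ x ^ (1 / 20 : ℝ) := by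
    calc (y : ℝ) ^ 3 * (K : ℝ) ^ 2 ≤ (x ^ (1 / 200 : ℝ)) ^ 3 * (x ^ (1 / 1000 : ℝ)) ^ 2 := by gcongr
      _ = x ^ (17 / 1000 : ℝ) := by
          rw [← Real.rpow_natCast, ← Real.rpow_natCast, ← Real.rpow_mul hx0.le, ← Real.rpow_mul hx0.le,
            ← Real.rpow_add hx0]; norm_num
      _ ≤ x ^ (1 / 20 : ℝ) := by
          apply Real.rpow_le_rpow_of_exponent_le _ (by norm_num)
          have : (1 : ℝ) ≤ Real.exp 1000 := by have := Real.add_one_le_exp (1000 : ℝ); linarith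
          linarith
  calc 19200 * Real.log x * (1 + Real.log x) ^ 2 * (y : ℝ) ^ 3 * (K : ℝ) ^ 2 * x ^ (4 / 5 : ℝ)
      = (19200 * L * (1 + L) ^ 2) * ((y : ℝ) ^ 3 * (K : ℝ) ^ 2) * x ^ (4 / 5 : ℝ) := by rw [hL]; ring
    _ ≤ x ^ (1 / 10 : ℝ) * x ^ (1 / 20 : ℝ) * x ^ (4 / 5 : ℝ) := by gcongr
    _ = x ^ (19 / 20 : ℝ) := by rw [← Real.rpow_add hx0, ← Real.rpow_add hx0]; norm_num

end Literature.NumberTheory.Sieve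

end
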